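import Summits.MatrixMultiplication.MatrixMultiplication.Theses.SchurWeylEquivariant
import Literature.Computability.AlgebraicComplexity.MatMulMonomialSubrank

set_option linter.dupNamespace false

/-!
# MatrixMultiplication / SchurWeylEquivariant — support `EquivariantRankBound`
(stmt-MatrixMultiplication-3556)

Glue for the assembly of route SchurWeylEquivariant: an `S_N`-equivariant decomposition of
`T_N = ⟨2,2,2⟩^{⊠N}` into `r` triads gives `R(⟨2^N,2^N,2^N⟩) ≤ r`.

The equivariance clause is decoration: forget it, read `⟨2^N,2^N,2^N⟩` as the restriction of
`⟨2,2,2⟩^{⊠N}` along the base-2 un-flattening maps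
(`matMulTensor_pow_eq_kroneckerPow_comp`, CVZ §2.1 / ADVXXZ 2025 §3.4:
"`⟨q,q,q⟩^{⊗n} ≡ ⟨qⁿ,qⁿ,qⁿ⟩`"), so `R(⟨2^N,2^N,2^N⟩) ≤ R(T_N)` (restriction along coordinate
maps does not increase rank, Bläser 2013, Lemma 5.4, `tensorRank_precomp_le`), and
`R(T_N) ≤ r` from the given decomposition (`tensorRank_le_of_eq_sum`).

References: M. Bläser, *Fast Matrix Multiplication*, Theory of Computing Graduate Surveys 5
(2013), §4 and Lemma 5.4; J. Alman, R. Duan, V. Vassilevska Williams, Y. Xu, Z. Xu, R. Zhou,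
*More asymmetry yields faster matrix multiplication*, SODA 2025, §3.4.
-/

noncomputable section

namespace Summit.MatrixMultiplication.MatrixMultiplication.Theorems

open Literature.Computability.AlgebraicComplexity

/-- Forgetful rank bound, route-independent form: any decomposition of `⟨2,2,2⟩^{⊠N}` into `r`
triads bounds `R(⟨2^N,2^N,2^N⟩)` by `r` (relabel `⟨2,2,2⟩^{⊠N} ≅ ⟨2^N,2^N,2^N⟩`, Bläser 2013
Lemma 5.4 for the coordinate maps). [cite: Blaser2013, Lemma 5.4]
[cite: AlmanDuanVassilevskaWilliamsXuXuZhou2025, §3.4] -/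
theorem tensorRank_matMulTensor_two_pow_le_of_eq_sum {N r : ℕ}
    (w u v : Fin r → (Fin N → Fin 2 × Fin 2) → ℂ)
    (hdec : kroneckerPow (matMulTensor ℂ 2 2 2) N = ∑ j, triad (w j) (u j) (v j)) :
    tensorRank (matMulTensor ℂ (2 ^ N) (2 ^ N) (2 ^ N)) ≤ r :=
  calc tensorRank (matMulTensor ℂ (2 ^ N) (2 ^ N) (2 ^ N))
      ≤ tensorRank (kroneckerPow (matMulTensor ℂ 2 2 2) N) := by
        rw [matMulTensor_pow_eq_kroneckerPow_comp ℂ 2 2 2 N]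
        exact tensorRank_precomp_le _ _ _ _
    _ ≤ r := tensorRank_le_of_eq_sum w u v hdec

/-- **Support item `EquivariantRankBound` of route SchurWeylEquivariant**
(stmt-MatrixMultiplication-3556), exact route decl: an `S_N`-equivariant decomposition of
`T_N = ⟨2,2,2⟩^{⊠N}` into `r` triads gives `R(⟨2^N,2^N,2^N⟩) ≤ r` (the equivariance clause is
forgotten; `tensorRank_matMulTensor_two_pow_le_of_eq_sum`). [cite: Blaser2013, Lemma 5.4]
[cite: AlmanDuanVassilevskaWilliamsXuXuZhou2025, §3.4] -/
theorem equivariantRankBound_proof :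
    Summit.MatrixMultiplication.MatrixMultiplication.Theses.SchurWeylEquivariant.EquivariantRankBound := by
  unfold Summit.MatrixMultiplication.MatrixMultiplication.Theses.SchurWeylEquivariant.EquivariantRankBound
  rintro N r ⟨w, u, v, hdec, -⟩
  exact tensorRank_matMulTensor_two_pow_le_of_eq_sum w u v hdec

end Summit.MatrixMultiplication.MatrixMultiplication.Theorems
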